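import Literature.Computability.QuantumComplexity.Lemma24Catalysis
import Literature.Computability.QuantumComplexity.ApproxImplementation
import HarnessLib

/-!
# Aaronson–Ambainis Lemma 24 over the sign basis, IV: a probability as one sign amplitude

Fourth file of the discharge of `AaronsonAmbainis2018_lemma24_sign_hard` (plan in
`Lemma24Catalysis.lean`). QSIM asks about the single transition amplitude
`A_Q = ⟨0…0| Q |0…0⟩` (`signAmplitude`, `QSimSign.lean`), whereas a `PromiseBQP` family is judged by
a measurement probability. Bennett's copy trick turns one into the other EXACTLY (this is the
"uncompute so that acceptance is returning to `|0ⁿ⟩`" of the printed proof of Lemma 24, p. 26;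
Bennett–Bernstein–Brassard–Vazirani 1997, proof of Thm. 4.14; Nielsen–Chuang 2010, §3.2.5): run the
gate list `S`, copy the flag wire `f` onto a fresh wire `f'` and negate it (`CNOT` then `X`, i.e. the
sign-basis word `H CZ H · H Z H` on `f'`), and run `S` backwards. Since every sign-basis gate is an
involution, the reversed list computes `S⁻¹ = S†`, and

  `⟨0| S† · X_{f'} CNOT_{f→f'} · S |0⟩ = Σ_{z : z_f = 1} |(S|0⟩)(z)|²`

(`signAmplitude_copyTrick`): the amplitude IS the probability that `f` reads `1` in `S|0⟩`, for ANY
gate list `S` not touching `f'` (garbage on other wires is harmless).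

* `sH`, `sZ`, `sCZ` — placed `H`, `Z`, `CZ` of `hSign`; `toMatrix_mul_self_sign` — every oracle-free
  sign gate is an involution; `toMatrix_reverse_mul_toMatrix` — the reversed list is the inverse;
* `xcnot` — the `4 × 4` permutation `|c, t⟩ ↦ |c, ¬(t ⊕ c)⟩` and `toMatrix_copyGates` (the six-gate
  word on `(f, f')` computes its placement);
* `suppIn_run_of_offWire` — a gate list not touching `f'` keeps `f' = 0`;
* **`signAmplitude_copyTrick`**.

## References

* S. Aaronson, A. Ambainis, *Forrelation*, SIAM J. Comput. 47 (2018), §6, Lemma 24 (p. 26: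
  acceptance as the amplitude of returning to `|0ⁿ⟩`).
* C. H. Bennett, E. Bernstein, G. Brassard, U. Vazirani, *Strengths and weaknesses of quantum
  computing*, SIAM J. Comput. 26 (1997), proof of Thm. 4.14 (compute, copy, uncompute).
* M. A. Nielsen, I. L. Chuang, *Quantum Computation and Quantum Information*, CUP 2010, §3.2.5, §4.3.
-/

noncomputable section

namespace Literature.Computability.QuantumComplexity

open Matrix _root_.Computability Complexity Cryptography Finset

namespace Lemma24

variable {N : ℕ}

/-! ### Placed sign gates and their involutivity -/

/-- `H` of the sign basis on wire `i`. [cite: AaronsonAmbainis2018, §6 (p. 26)] -/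
def sH (i : Fin N) : QGate hSign N := QGate.gate HSignOp.H (wireEmb i)

/-- `Z` of the sign basis on wire `i`. [cite: AaronsonAmbainis2018, §6 (p. 26)] -/
def sZ (i : Fin N) : QGate hSign N := QGate.gate HSignOp.Z (wireEmb i)

/-- `CZ` of the sign basis on the wires `i ≠ j`. [cite: AaronsonAmbainis2018, §6 (p. 26)] -/
def sCZ (i j : Fin N) (h : i ≠ j) : QGate hSign N := QGate.gate HSignOp.CZ (pairEmb i j h)

/-- `Z² = 1`. [cite: NielsenChuang2010, §2.1.8] -/
theorem pauliZ_mul_pauliZ : pauliZ * pauliZ = (1 : Matrix (QReg 1) (QReg 1) ℂ) := by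
  refine matrix_qReg_one_ext fun a b => ?_
  rw [Matrix.mul_apply, sum_qReg_one, Fintype.sum_bool, Matrix.one_apply]
  cases a <;> cases b <;> simp [pauliZ, funext_iff]

/-- `CZ² = 1`. [cite: NielsenChuang2010, §4.3] -/
theorem cz_mul_cz : cz * cz = (1 : Matrix (QReg 2) (QReg 2) ℂ) := by
  apply (Matrix.reindexRingEquiv ℂ qRegTwoEquiv).injective
  rw [map_mul, map_one, Matrix.coe_reindexRingEquiv, reindex_cz]
  ext i j
  fin_cases i <;> fin_cases j <;> simp [csignTwo, Matrix.mul_apply, Fin.sum_univ_four]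

/-- `CCZ² = 1`. [cite: NielsenChuang2010, §4.3] -/
theorem ccsign_mul_ccsign : ccsign * ccsign = (1 : Matrix (QReg 3) (QReg 3) ℂ) := by
  rw [ccsign, Matrix.diagonal_mul_diagonal, ← Matrix.diagonal_one]
  congr 1
  funext x
  split_ifs <;> norm_num

/-- **Every oracle-free sign gate is an involution.** [cite: NielsenChuang2010, §2.1.8, §4.3] -/
theorem toMatrix_mul_self_sign (g : QGate hSign N) (hg : g.IsOracleFree) : g.toMatrix 0 * g.toMatrix 0 = 1 := by
  rcases g with ⟨g, e⟩ | ⟨m, e⟩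
  · rcases g with _ | _ | _ | _
    · rw [toMatrix_sign_H, ← placeGate_mul_holds, hGate_mul_hGate, placeGate_one]
    · rw [toMatrix_sign_Z, ← placeGate_mul_holds, pauliZ_mul_pauliZ, placeGate_one]
    · rw [toMatrix_sign_CZ, ← placeGate_mul_holds, cz_mul_cz, placeGate_one]
    · rw [toMatrix_sign_CCZ, ← placeGate_mul_holds, ccsign_mul_ccsign, placeGate_one]
  · exact absurd hg id

/-- The matrix of a reversed gate list is the product in list order. [folklore] -/
theorem toMatrix_reverse_eq_prod {G : QGateSet} (A : Language Bool) (gs : List (QGate G N)) :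
    (⟨gs.reverse⟩ : QCircuit G N).toMatrix A = (gs.map (QGate.toMatrix A)).prod := by
  simp [QCircuit.toMatrix, List.map_reverse]

/-- A list of involutions times its reverse is the identity. [folklore] -/
theorem prod_reverse_mul_prod_of_involutive {R : Type*} [Monoid R] :
    ∀ (l : List R), (∀ a ∈ l, a * a = 1) → l.reverse.prod * l.prod = 1
  | [], _ => by simp
  | a :: l, h => by
    rw [List.reverse_cons, List.prod_append, List.prod_singleton, List.prod_cons, mul_assoc,
      ← mul_assoc a a, h a (by simp), one_mul]
    exact prod_reverse_mul_prod_of_involutive l fun b hb => h b (by simp [hb])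

/-- **Running an oracle-free sign list backwards undoes it**: `⟦gs⟧ · ⟦gs.reverse⟧ = 1`.
[cite: NielsenChuang2010, §3.2.5 (uncomputation)] -/
theorem toMatrix_mul_toMatrix_reverse (gs : List (QGate hSign N)) (h : ∀ g ∈ gs, g.IsOracleFree) :
    (⟨gs⟩ : QCircuit hSign N).toMatrix 0 * (⟨gs.reverse⟩ : QCircuit hSign N).toMatrix 0 = 1 := by
  rw [toMatrix_reverse_eq_prod, QCircuit.toMatrix]
  exact prod_reverse_mul_prod_of_involutive _ fun M hM => by
    obtain ⟨g, hg, rfl⟩ := List.mem_map.1 hM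
    exact toMatrix_mul_self_sign g (h g hg)

/-- `⟦gs.reverse⟧ · ⟦gs⟧ = 1` as well. [cite: NielsenChuang2010, §3.2.5 (uncomputation)] -/
theorem toMatrix_reverse_mul_toMatrix (gs : List (QGate hSign N)) (h : ∀ g ∈ gs, g.IsOracleFree) :
    (⟨gs.reverse⟩ : QCircuit hSign N).toMatrix 0 * (⟨gs⟩ : QCircuit hSign N).toMatrix 0 = 1 := by
  have := toMatrix_mul_toMatrix_reverse gs.reverse (fun g hg => h g (List.mem_reverse.1 hg))
  rwa [List.reverse_reverse] at this

/-- Hence the reversed list computes the adjoint: `⟦gs.reverse⟧ = ⟦gs⟧ᴴ`. [cite: NielsenChuang2010, §3.2.5] -/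
theorem toMatrix_reverse_eq_conjTranspose (gs : List (QGate hSign N)) (h : ∀ g ∈ gs, g.IsOracleFree) :
    (⟨gs.reverse⟩ : QCircuit hSign N).toMatrix 0 = ((⟨gs⟩ : QCircuit hSign N).toMatrix 0)ᴴ := by
  have hU := QCircuit.toMatrix_mem_unitaryGroup_holds hSign_isUnitary 0 (⟨gs⟩ : QCircuit hSign N)
  have hinv : ((⟨gs⟩ : QCircuit hSign N).toMatrix 0)⁻¹ = (⟨gs.reverse⟩ : QCircuit hSign N).toMatrix 0 :=
    Matrix.inv_eq_left_inv (toMatrix_reverse_mul_toMatrix gs h)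
  have hinv' : ((⟨gs⟩ : QCircuit hSign N).toMatrix 0)⁻¹ = ((⟨gs⟩ : QCircuit hSign N).toMatrix 0)ᴴ :=
    Matrix.inv_eq_right_inv (Matrix.mem_unitaryGroup_iff.1 hU)
  rw [← hinv, hinv']

/-! ### The copy-and-negate word on the pair `(f, f')` -/

/-- The permutation `|c, t⟩ ↦ |c, ¬(t ⊕ c)⟩` (`X` on the target after `CNOT`), as a `4 × 4` matrix on
two wires (control = wire `0`). [cite: NielsenChuang2010, §4.3] -/
def xcnot : Matrix (QReg 2) (QReg 2) ℂ :=
  Matrix.of fun x y => if x 0 = y 0 ∧ x 1 = !(y 1 ^^ y 0) then 1 else 0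

/-- The six-gate word on `(f, f')`: `H_{f'} CZ_{f f'} H_{f'}` (`= CNOT_{f→f'}`) then `H_{f'} Z_{f'} H_{f'}`
(`= X_{f'}`). [cite: NielsenChuang2010, §4.3 and Ex. 4.18 (HZH = X)] -/
def copyGates (f f' : Fin N) (h : f ≠ f') : List (QGate hSign N) :=
  [sH f', sCZ f f' h, sH f', sH f', sZ f', sH f']

/-- All gates of the copy word are oracle-free. [folklore] -/
theorem copyGates_isOracleFree (f f' : Fin N) (h : f ≠ f') : ∀ g ∈ copyGates f f' h, g.IsOracleFree := by
  intro g hg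
  simp only [copyGates, List.mem_cons, List.mem_nil_iff, or_false] at hg
  rcases hg with rfl | rfl | rfl | rfl | rfl | rfl <;> exact trivial

/-- The copy word touches only `f` and `f'`. [folklore] -/
theorem mem_wires_copyGates {f f' : Fin N} (h : f ≠ f') {g : QGate hSign N} (hg : g ∈ copyGates f f' h)
    {w : Fin N} (hw : w ∈ g.wires) : w = f ∨ w = f' := by
  simp only [copyGates, List.mem_cons, List.mem_nil_iff, or_false] at hg
  rcases hg with rfl | rfl | rfl | rfl | rfl | rfl <;>
    simp only [sH, sZ, sCZ, QGate.wires, Finset.mem_map, Finset.mem_univ, true_and] at hw <;>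
    obtain ⟨j, rfl⟩ := hw
  all_goals first
    | exact Or.inr rfl
    | (fin_cases j <;> first | exact Or.inl rfl | exact Or.inr rfl)

/-- The integer pattern of `H` on the second of two wires (times `√2`). [cite: NielsenChuang2010, §4.2] -/
def hm : Matrix (Fin 4) (Fin 4) ℂ := !![1, 1, 0, 0; 1, -1, 0, 0; 0, 0, 1, 1; 0, 0, 1, -1]

/-- `Z` on the second of two wires, explicitly. [cite: NielsenChuang2010, §4.2] -/
def zm : Matrix (Fin 4) (Fin 4) ℂ := !![1, 0, 0, 0; 0, -1, 0, 0; 0, 0, 1, 0; 0, 0, 0, -1]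

/-- `X` on the second of two wires, explicitly. [cite: NielsenChuang2010, §4.2] -/
def xm : Matrix (Fin 4) (Fin 4) ℂ := !![0, 1, 0, 0; 1, 0, 0, 0; 0, 0, 0, 1; 0, 0, 1, 0]

/-- `CNOT` (control the first wire), explicitly. [cite: NielsenChuang2010, §4.3] -/
def cnotm : Matrix (Fin 4) (Fin 4) ℂ := !![1, 0, 0, 0; 0, 1, 0, 0; 0, 0, 0, 1; 0, 0, 1, 0]

/-- `X₂ · CNOT`, explicitly. [cite: NielsenChuang2010, §4.3] -/
def xcnotm : Matrix (Fin 4) (Fin 4) ℂ := !![0, 1, 0, 0; 1, 0, 0, 0; 0, 0, 1, 0; 0, 0, 0, 1]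

/-- `Z` placed on the second of two wires is `zm`. [cite: NielsenChuang2010, §4.2] -/
theorem reindex_onSecond_pauliZ :
    Matrix.reindex qRegTwoEquiv qRegTwoEquiv (placeGate (wireEmb (1 : Fin 2)) pauliZ) = zm := by
  rw [show placeGate (wireEmb (1 : Fin 2)) pauliZ = onSecond pauliZ from rfl, reindex_onSecond]
  ext i j
  fin_cases i <;> fin_cases j <;> simp [pauliZ, funext_iff, zm]

/-- `H` placed on the second of two wires is `(1/√2) hm`. [cite: NielsenChuang2010, §4.2] -/
theorem reindex_onSecond_hGate :
    Matrix.reindex qRegTwoEquiv qRegTwoEquiv (placeGate (wireEmb (1 : Fin 2)) hGate) = invSqrt2 • hm := by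
  rw [show placeGate (wireEmb (1 : Fin 2)) hGate = onSecond hGate from rfl, reindex_onSecond]
  ext i j
  fin_cases i <;> fin_cases j <;> simp [hGate, invSqrt2, hm]

/-- `xcnot` is `xcnotm`. [cite: NielsenChuang2010, §4.3] -/
theorem reindex_xcnot : Matrix.reindex qRegTwoEquiv qRegTwoEquiv xcnot = xcnotm := by
  ext i j
  fin_cases i <;> fin_cases j <;> simp [qRegTwoEquiv, xcnot, xcnotm]

/-- `hm · zm · hm = 2 X₂` (`H Z H = X`). [cite: NielsenChuang2010, Ex. 4.18] -/
theorem hm_zm_hm : hm * zm * hm = (2 : ℂ) • xm := by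
  ext i j
  fin_cases i <;> fin_cases j <;> simp [hm, zm, xm, Matrix.mul_apply, Fin.sum_univ_four] <;> norm_num

/-- `hm · CZ · hm = 2 CNOT` (`(1 ⊗ H) CZ (1 ⊗ H) = CNOT`). [cite: NielsenChuang2010, §4.3] -/
theorem hm_csignTwo_hm : hm * csignTwo * hm = (2 : ℂ) • cnotm := by
  ext i j
  fin_cases i <;> fin_cases j <;> simp [hm, csignTwo, cnotm, Matrix.mul_apply, Fin.sum_univ_four] <;> norm_num

/-- `X₂ · CNOT = xcnotm`. [cite: NielsenChuang2010, §4.3] -/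
theorem xm_mul_cnotm : xm * cnotm = xcnotm := by
  ext i j
  fin_cases i <;> fin_cases j <;> simp [xm, cnotm, xcnotm, Matrix.mul_apply, Fin.sum_univ_four]

/-- `(1/√2)² · 2 = 1`. [folklore] -/
theorem invSqrt2_sq_mul_two : invSqrt2 * invSqrt2 * 2 = 1 := by
  rw [invSqrt2_mul_invSqrt2]; norm_num

/-- **The two-wire identity** `(H₂ Z₂ H₂)(H₂ CZ H₂) = xcnot` (`X · CNOT`). [cite: NielsenChuang2010, §4.3 and Ex. 4.18] -/
theorem copyWord_two :
    placeGate (wireEmb (1 : Fin 2)) hGate * placeGate (wireEmb (1 : Fin 2)) pauliZ *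
        placeGate (wireEmb (1 : Fin 2)) hGate *
        (placeGate (wireEmb (1 : Fin 2)) hGate * cz * placeGate (wireEmb (1 : Fin 2)) hGate) = xcnot := by
  apply (Matrix.reindexRingEquiv ℂ qRegTwoEquiv).injective
  simp only [map_mul, Matrix.coe_reindexRingEquiv, reindex_onSecond_hGate, reindex_onSecond_pauliZ, reindex_cz,
    reindex_xcnot, Matrix.smul_mul, Matrix.mul_smul, smul_smul, hm_zm_hm, hm_csignTwo_hm]
  have e : invSqrt2 * (invSqrt2 * 2) = 1 := by rw [← mul_assoc]; exact invSqrt2_sq_mul_two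
  rw [e, one_mul, one_smul, xm_mul_cnotm]

/-- **The copy word computes the placement of `xcnot` on `(f, f')`.** [cite: NielsenChuang2010, §4.3] -/
theorem toMatrix_copyGates (f f' : Fin N) (h : f ≠ f') :
    (⟨copyGates f f' h⟩ : QCircuit hSign N).toMatrix 0 = placeGate (pairEmb f f' h) xcnot := by
  have eH : (sH f' : QGate hSign N).toMatrix 0 = placeGate (pairEmb f f' h) (placeGate (wireEmb (1 : Fin 2)) hGate) := by
    rw [sH, toMatrix_sign_H, placeGate_placeGate, wireEmb_trans, pairEmb_one]
  have eZ : (sZ f' : QGate hSign N).toMatrix 0 = placeGate (pairEmb f f' h) (placeGate (wireEmb (1 : Fin 2)) pauliZ) := by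
    rw [sZ, toMatrix_sign_Z, placeGate_placeGate, wireEmb_trans, pairEmb_one]
  have eC : (sCZ f f' h : QGate hSign N).toMatrix 0 = placeGate (pairEmb f f' h) cz := by
    rw [sCZ, toMatrix_sign_CZ]
  have pm : ∀ U V : Matrix (QReg 2) (QReg 2) ℂ,
      placeGate (pairEmb f f' h) U * placeGate (pairEmb f f' h) V = placeGate (pairEmb f f' h) (U * V) :=
    fun U V => (placeGate_mul_holds (pairEmb f f' h) U V).symm
  simp only [copyGates, QCircuit.toMatrix, List.map_cons, List.map_nil, List.reverse_cons, List.reverse_nil,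
    List.nil_append, List.cons_append, List.prod_cons, List.prod_nil, mul_one, eH, eZ, eC, pm, ← mul_assoc]
  rw [← copyWord_two]
  simp only [mul_assoc]

/-! ### Gate lists not touching a wire -/

/-- **A gate list none of whose gates touches the wire `f'` keeps `f'` at `0`** (starting from any
state supported on `f' = 0`). [cite: NielsenChuang2010, §4.3] -/
theorem suppIn_run_of_offWire {f' : Fin N} (gs : List (QGate hSign N))
    (hoff : ∀ g ∈ gs, f' ∉ g.wires) {ψ : QReg N → ℂ} (hψ : SuppIn {z | z f' = false} ψ) :
    SuppIn {z | z f' = false} ((⟨gs⟩ : QCircuit hSign N).toMatrix 0 *ᵥ ψ) := by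
  induction gs generalizing ψ with
  | nil => simpa using hψ
  | cons g gs ih =>
    rw [QCircuit.toMatrix_cons, ← Matrix.mulVec_mulVec]
    refine ih (fun g' hg' => hoff g' (by simp [hg'])) ?_
    have hg : f' ∉ g.wires := hoff g (by simp)
    rcases g with ⟨op, e⟩ | ⟨m, e⟩
    · have hrange : f' ∉ Set.range e := by
        rintro ⟨j, rfl⟩
        exact hg (by simp [QGate.wires])
      refine preservesSupp_placeGate_of_offWires e (fun x y hxy => ?_) _ ψ hψ
      simp only [Set.mem_setOf_eq]
      rw [hxy f' hrange]
    · have hrange : f' ∉ Set.range e := by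
        rintro ⟨j, rfl⟩
        exact hg (by simp [QGate.wires])
      refine preservesSupp_placeGate_of_offWires e (fun x y hxy => ?_) _ ψ hψ
      simp only [Set.mem_setOf_eq]
      rw [hxy f' hrange]

/-- The all-zero label has `f' = 0`. [folklore] -/
theorem suppIn_basisState_zero (f' : Fin N) : SuppIn {z : QReg N | z f' = false} (basisState fun _ => false) :=
  suppIn_basisState rfl

/-! ### The amplitude of the copy trick -/

/-- **The copy trick circuit**: `S`, then copy-and-negate `f` onto `f'`, then `S` backwards.
[cite: BennettBernsteinBrassardVazirani1997, Thm. 4.14 (proof)] -/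
def copyTrick (S : List (QGate hSign N)) (f f' : Fin N) (h : f ≠ f') : QCircuit hSign N :=
  ⟨S ++ (copyGates f f' h ++ S.reverse)⟩

/-- The copy trick circuit is oracle-free when `S` is. [folklore] -/
theorem copyTrick_isOracleFree {S : List (QGate hSign N)} (hS : ∀ g ∈ S, g.IsOracleFree) (f f' : Fin N) (h : f ≠ f') :
    (copyTrick S f f' h).IsOracleFree := by
  intro g hg
  simp only [copyTrick, List.mem_append, List.mem_reverse] at hg
  rcases hg with hg | hg | hg
  · exact hS g hg
  · exact copyGates_isOracleFree f f' h g hg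
  · exact hS g hg

/-- The size of the copy trick circuit. [folklore] -/
theorem size_copyTrick (S : List (QGate hSign N)) (f f' : Fin N) (h : f ≠ f') :
    (copyTrick S f f' h).size = 2 * S.length + 6 := by
  simp [copyTrick, QCircuit.size, copyGates]; omega

/-- The matrix of the copy trick: `⟦S⟧ᴴ · xcnot_{f,f'} · ⟦S⟧`. [cite: BennettBernsteinBrassardVazirani1997, Thm. 4.14 (proof)] -/
theorem toMatrix_copyTrick {S : List (QGate hSign N)} (hS : ∀ g ∈ S, g.IsOracleFree) (f f' : Fin N) (h : f ≠ f') :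
    (copyTrick S f f' h).toMatrix 0 =
      ((⟨S⟩ : QCircuit hSign N).toMatrix 0)ᴴ * placeGate (pairEmb f f' h) xcnot * (⟨S⟩ : QCircuit hSign N).toMatrix 0 := by
  have e1 : copyTrick S f f' h = (⟨S⟩ : QCircuit hSign N).append ((⟨copyGates f f' h⟩ : QCircuit hSign N).append ⟨S.reverse⟩) := rfl
  rw [e1, QCircuit.toMatrix_append, QCircuit.toMatrix_append, toMatrix_copyGates,
    toMatrix_reverse_eq_conjTranspose S hS]

/-- The label obtained from `z` by the permutation of `xcnot` on `(f, f')`: `f' ↦ ¬(z f' ⊕ z f)`. [folklore] -/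
def flipLabel (f f' : Fin N) (z : QReg N) : QReg N := Function.update z f' (!(z f' ^^ z f))

/-- Entries of the placed `xcnot`: `1` exactly at `(flipLabel z, z)`. [cite: NielsenChuang2010, §4.3] -/
theorem placeGate_xcnot_apply (f f' : Fin N) (h : f ≠ f') (z' z : QReg N) :
    placeGate (pairEmb f f' h) xcnot z' z = if z' = flipLabel f f' z then 1 else 0 := by
  rw [placeGate_apply]
  have key : ((∀ i, i ∉ Set.range (pairEmb f f' h) → z' i = z i) ∧
      (z' f = z f ∧ z' f' = !(z f' ^^ z f))) ↔ z' = flipLabel f f' z := by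
    rw [flipLabel, Function.eq_update_iff, range_pairEmb]
    simp only [Set.mem_insert_iff, Set.mem_singleton_iff, not_or]
    constructor
    · rintro ⟨h1, h2, h3⟩
      refine ⟨h3, fun l hl => ?_⟩
      by_cases hlf : l = f
      · subst hlf; exact h2
      · exact h1 l ⟨hlf, hl⟩
    · rintro ⟨h3, h1⟩
      exact ⟨fun l hl => h1 l hl.2, h1 f h, h3⟩
  simp only [xcnot, Matrix.of_apply, Function.comp_apply, pairEmb_zero, pairEmb_one]
  by_cases h1 : ∀ i, i ∉ Set.range (pairEmb f f' h) → z' i = z i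
  · rw [if_pos h1]
    by_cases h2 : z' f = z f ∧ z' f' = !(z f' ^^ z f)
    · rw [if_pos h2, if_pos (key.1 ⟨h1, h2⟩)]
    · rw [if_neg h2, if_neg (fun h' => h2 (key.2 h').2)]
  · rw [if_neg h1, if_neg (fun h' => h1 (key.2 h').1)]

/-- **The amplitude of the copy trick is a probability**:
`⟨0…0| copyTrick S f f' |0…0⟩ = Σ_{z : z f = 1} |(⟦S⟧|0…0⟩)(z)|²` for every oracle-free sign list `S`
not touching `f'`. [cite: BennettBernsteinBrassardVazirani1997, Thm. 4.14 (proof)] [cite: AaronsonAmbainis2018, §6 Lemma 24 (p. 26)] -/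
theorem signAmplitude_copyTrick {S : List (QGate hSign N)} (hS : ∀ g ∈ S, g.IsOracleFree) {f f' : Fin N} (h : f ≠ f')
    (hoff : ∀ g ∈ S, f' ∉ g.wires) :
    (signAmplitude (copyTrick S f f' h) : ℂ) =
      ∑ z : QReg N, if z f = true then
        (‖((⟨S⟩ : QCircuit hSign N).toMatrix 0 *ᵥ basisState (fun _ => false)) z‖ ^ 2 : ℂ) else 0 := by
  have hsupp : SuppIn {z : QReg N | z f' = false}
      (((⟨S⟩ : QCircuit hSign N).toMatrix 0) *ᵥ basisState (fun _ => false)) :=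
    suppIn_run_of_offWire S hoff (suppIn_basisState_zero f')
  have hψz : ∀ z, ((⟨S⟩ : QCircuit hSign N).toMatrix 0) z (fun _ => false) =
      (((⟨S⟩ : QCircuit hSign N).toMatrix 0) *ᵥ basisState (fun _ => false)) z := fun z => by
    rw [mulVec_basisState]
  rw [signAmplitude_coe, QCircuit.mat, toMatrix_copyTrick hS f f' h, Matrix.mul_apply]
  refine Finset.sum_congr rfl fun z _ => ?_
  -- the inner product over the placed permutation picks the flipped label
  have inner : (((⟨S⟩ : QCircuit hSign N).toMatrix 0)ᴴ * placeGate (pairEmb f f' h) xcnot) (fun _ => false) z =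
      star ((((⟨S⟩ : QCircuit hSign N).toMatrix 0) *ᵥ basisState (fun _ => false)) (flipLabel f f' z)) := by
    rw [Matrix.mul_apply, Finset.sum_eq_single (flipLabel f f' z)]
    · rw [placeGate_xcnot_apply, if_pos rfl, mul_one, Matrix.conjTranspose_apply, hψz]
    · intro z' _ hz'
      rw [placeGate_xcnot_apply, if_neg hz', mul_zero]
    · intro hnot; exact absurd (Finset.mem_univ _) hnot
  rw [inner, hψz z]
  by_cases hzf' : z f' = false
  · by_cases hzf : z f = true
    · -- the flipped label is `z` itself
      have hflip : flipLabel f f' z = z := by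
        rw [flipLabel, Function.update_eq_self_iff, hzf', hzf]; rfl
      rw [hflip, if_pos hzf, Complex.star_def, Complex.conj_mul']
    · -- `z f = 0`: the flipped label has `f' = 1`, where the state vanishes
      have hzf0 : z f = false := by simpa using hzf
      have hflip : (flipLabel f f' z) f' = true := by rw [flipLabel, Function.update_self, hzf', hzf0]; rfl
      rw [if_neg hzf, hsupp _ (by simp [hflip]), star_zero, zero_mul]
  · -- `z f' = 1`: the state vanishes at `z`
    rw [hsupp z (by simpa using hzf'), mul_zero]
    split_ifs <;> simp

end Lemma24

end Literature.Computability.QuantumComplexity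

end
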